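import Summits.HodgeConjecture.HodgeConjecture.Theorems.Ring2BindersAbelianSchemeVHCPrimitiveMiddleLift
import Summits.HodgeConjecture.HodgeConjecture.Theorems.Ring2HypothesesDescentMotivatedExteriorSumHardLefschetz
import Literature.AlgebraicGeometry.HodgeTheory.PolarizationClassExistence
import Literature.AlgebraicGeometry.Motives.AbelianVarietyExistence
import HarnessLib

/-!
# Ring 2 — binder seat b02 (Hodge ladder stage 3): the primitive one-step lift ALONG AN ABELIAN-FIBRED FAMILY and the
# induction on the Lefschetz defect — fibrewise-primitive MIDDLE classes decide all fibrewise-primitive classes (fact-free)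

HONEST FRAMING: research route conditional on HC_CM; not a corollary; Q11.4-sentence-2 already refuted in dim ≥ 3.

Cell `pub-hodge-ring2`, binder seat `ring2-b02`, row b02 of `BINDER-OWNERS.md` (`Ring2.Hypotheses.AbelianSchemeVHC`,
`Theorems/Ring2Hypotheses.lean`; OPEN, print-equivalent to `HC_AV`, nothing to discharge). `HC_CM`
(`Theses.RankFourFaces.CMAbelianHodge`) does not occur below; nothing here is a case of the Hodge conjecture; no `sorry`, no
definition, no NEW Literature fact, no node; «10 · 0» untouched.

WHAT THIS PART DOES. The lift part (`Ring2BindersAbelianSchemeVHCPrimitiveMiddleLift.lean`) constructs, on ONE product `X × E` of a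
polarised smooth projective `n`-fold `X ≅` an abelian variety with an elliptic curve `E`, from a class `c ∈ P^{2p}(X, η)` of Lefschetz
defect `n - 2p = r + 1`, the class `z = L_{pr₁^*η}(pr₁^*c) - (r + 1) · L_{pr₂^*K_E}(pr₁^*c)` — PRIMITIVE for the exterior-sum
polarisation `pr₁^*η + pr₂^*K_E` of the `(n+1)`-fold `X × E`, of defect `r`, rational / of type `(p+1, p+1)` when `c` is rational /
of type `(p, p)`, and algebraic iff `c` is (Lieberman's `A(X, η)` for the descent). Here:

* §1 **`exists_primitiveOneStepLift`** — the same ALONG a smooth projective abelian-fibred family `f : 𝒳 ⟶ S` of relative dimension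
  `n = 2p + (r + 1)` with a global class `K` polarising every fibre: on `pr_𝒳 ≫ f : 𝒳 × E ⟶ S` (relative dimension `n + 1`,
  abelian fibres `A' × E` — the middle-lift part's `isSmoothProjectiveFamily_fst_comp`, `exists_abelianVariety_iso_fiberOver_fst_comp`)
  the global classes `K♯ := pr_𝒳^*K + pr_E^*K_E` and `W♯ := L_{pr_𝒳^*K}(pr_𝒳^*W) - (r + 1) · L_{pr_E^*K_E}(pr_𝒳^*W) ∈ H^{2(p+1)}` satisfy:
  `K♯|` polarises every fibre — THE EXTERIOR SUM OF TWO POLARISATIONS IS A POLARISATION, `isPolarizationClass_boxSum`, i.e. the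
  hard Lefschetz theorem for `𝓛_X ⊠ 𝓛_E` proved on the real carriers by row b05's seat
  (`Ring2HypothesesDescentMotivatedExteriorSumHardLefschetz.lean`, Kleiman 1968 Thm. 2.9 / André 1996 §1.3, `𝔰𝔩₂ ⊗ 𝔰𝔩₂`) —,
  `W♯|` is rational of type `(p+1, p+1)`, `K♯|`-PRIMITIVE of defect `r`, and algebraic iff `W|` is, at EVERY fibre (the lift
  part's §2 read on `𝒳_s × E ≅ (𝒳 × E)_s` and transported along that isomorphism: `IsPolarizationClass.map_of_iso`,
  `isOfHodgeType_map_iff_of_iso`, `mem_algebraicClasses_map_iff_of_iso`, `map_mem_primitiveClasses`).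
* §2 **`map_fiberι_mem_algebraicClasses_of_primitiveMiddleFrom_of_mem_primitiveClasses`** — THE INDUCTION ON THE DEFECT: if row
  b02 holds for fibrewise-primitive classes of the MIDDLE degree on abelian schemes of (even) relative dimension `≥ g`
  (`AbelianSchemeVHCPrimitiveMiddleFrom[g]`, file-local notation), then it holds for fibrewise-primitive classes `W ∈ H²ᵖ`,
  `2 ≤ p`, of EVERY defect `n - 2p` on abelian schemes of relative dimension `n ≥ g`, for every global polarising class, anchor
  and fibre — pad by one elliptic curve per unit of defect (`exists_abelianVariety_dim_eq_one`, `exists_isPolarizationClass`).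
  No quasi-projectivity of the total space is needed: the polarising class of `𝒳 × E` is built from `K`.

Everything is FACT-FREE (closures: the three standard axioms). The binder-level statements are the sequel
`Ring2BindersAbelianSchemeVHCPrimitiveMiddle.lean`. What is NOT claimed: any case of `AbelianSchemeVHC` or of HC; anything about
`HC_CM`; anything for carriers whose total space is not quasi-projective beyond what is stated (the print residual N96 / N97,
Raynaud 1970, enters only in the sequel, as a hypothesis).

References: [VoisinHodgeI2002] §6.2.3 Def. 6.24, Thm. 6.25, Cor. 6.26, Rem. 6.27, §7.1.2, §7.3.2; [VoisinHodgeII2003] §9.2.4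
Prop. 9.20, proof of Prop. 9.21 (i); [Kleiman1968AlgebraicCycles] §1.4, Thm. 2.9, Thm. 2A11; [Andre1996Motifs] §1.1, §1.3;
[Lieberman1968] main theorem; [KerrPearlstein2011] §3.1; [BrosnanFangNiePearlstein2009] §6 Lemma 48; [CharlesSchnell2014Notes]
Conj. 11.3.1, Prop. 11.3.11; [Hartshorne1977] II.3 p. 89, III Prop. 10.1; [MumfordAV1970] §1; [SilvermanAEC2009] III.3.
-/

-- every declaration of this problem lives in `Summit.HodgeConjecture.HodgeConjecture.…` (summit = sub-problem);
-- namespace `…Ring2.Binders` = the binder seats of the cell's Hodge-ladder stage 3 (`BINDER-OWNERS.md`)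
set_option linter.dupNamespace false

noncomputable section

open CategoryTheory CategoryTheory.Limits AlgebraicGeometry Topology MonoidalCategory CartesianMonoidalCategory
open Literature.AlgebraicGeometry Literature.AlgebraicGeometry.Motives
open Literature.AlgebraicGeometry.HodgeTheory
open Literature.Geometry.Kaehler (lefschetzOperator)

namespace Summit.HodgeConjecture.HodgeConjecture.Ring2.Binders

open Summit.HodgeConjecture.HodgeConjecture.Theorems (isPolarizationClass_boxSum)

/-! ## §1 Along an abelian-fibred family: the one-step lift `𝒳 ↦ 𝒳 × E`, fibre by fibre -/

section Family

variable {𝒳 S : SchemeOver ℂ}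

/-- Pull-back along `φ ▷ B` of a class pulled back from the first factor: `(φ ▷ B)^* pr₁^* y = pr₁^* φ^* y`.
[cite: Hartshorne1977, II.3 (p. 89)] -/
theorem map_whiskerRight_map_fst {X' X : SchemeOver ℂ} (φ : X' ⟶ X) (B : SchemeOver ℂ) {i : ℕ} (y : complexBetti X i) :
    complexBetti.map (φ ▷ B) i (complexBetti.map (fst X B) i y) = complexBetti.map (fst X' B) i (complexBetti.map φ i y) := by
  rw [← complexBetti.map_comp_apply', whiskerRight_fst, complexBetti.map_comp_apply']

/-- Pull-back along `φ ▷ B` of a class pulled back from the second factor: `(φ ▷ B)^* pr₂^* y = pr₂^* y`.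
[cite: Hartshorne1977, II.3 (p. 89)] -/
theorem map_whiskerRight_map_snd {X' X : SchemeOver ℂ} (φ : X' ⟶ X) (B : SchemeOver ℂ) {i : ℕ} (y : complexBetti B i) :
    complexBetti.map (φ ▷ B) i (complexBetti.map (snd X B) i y) = complexBetti.map (snd X' B) i y := by
  rw [← complexBetti.map_comp_apply', whiskerRight_snd]

/-- **Restriction to a fibre of `𝒳 × B ⟶ S` factors through `𝒳_s × B`**: with `e : 𝒳_s × B ≅ (𝒳 × B)_s` of the middle-lift part
(`exists_fiberOver_fst_comp_iso`), `(·)|_{(𝒳 × B)_s} = e⁻¹^* ∘ (ι_s ▷ B)^*`. [cite: Hartshorne1977, II.3 (p. 89) and III Prop. 10.1 (b)] -/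
theorem exists_iso_map_fiberι_fst_comp_eq (f : 𝒳 ⟶ S) (B : SchemeOver ℂ) (s : ComplexPoints S) :
    ∃ e : fiberOver f s ⊗ B ≅ fiberOver (fst 𝒳 B ≫ f) s, ∀ (i : ℕ) (y : complexBetti (𝒳 ⊗ B) i),
      complexBetti.map (fiberι (fst 𝒳 B ≫ f) s) i y = complexBetti.map e.inv i (complexBetti.map (fiberι f s ▷ B) i y) := by
  obtain ⟨e, he⟩ := exists_fiberOver_fst_comp_iso f B s
  refine ⟨e, fun i y ↦ ?_⟩
  rw [e.eq_inv_comp.2 he, complexBetti.map_comp_apply']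

/-- **THE PRIMITIVE ONE-STEP LIFT ALONG A FAMILY.** Let `f : 𝒳 ⟶ S` be a smooth projective family of relative dimension
`n = 2p + (r + 1)` all of whose complex fibres are abelian varieties, `K ∈ H²(𝒳(ℂ); ℂ)` a global class polarising every
fibre, `E` an elliptic curve (an abelian variety of dimension `1`) with a polarisation class `K_E`, and `W ∈ H²ᵖ(𝒳(ℂ); ℂ)`
fibrewise rational of type `(p,p)` and fibrewise `K|`-PRIMITIVE. On the smooth projective abelian-fibred family
`pr_𝒳 ≫ f : 𝒳 × E ⟶ S` of relative dimension `n + 1` the global classes `K♯ := pr_𝒳^*K + pr_E^*K_E` and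
`W♯ := L_{pr_𝒳^*K}(pr_𝒳^*W) - (r + 1) · L_{pr_E^*K_E}(pr_𝒳^*W) ∈ H^{2(p+1)}((𝒳 × E)(ℂ); ℂ)` satisfy: `K♯` polarises every fibre
(the exterior sum of two polarisations, `isPolarizationClass_boxSum` — hard Lefschetz for `𝓛_X ⊠ 𝓛_E` by the `𝔰𝔩₂ ⊗ 𝔰𝔩₂`
argument, a tree theorem of row b05's seat); `W♯` is fibrewise rational of type `(p+1, p+1)`, fibrewise `K♯|`-PRIMITIVE — its
Lefschetz DEFECT `(n + 1) - 2(p + 1) = r` is one less than that of `W` —, and `W♯|` is algebraic iff `W|` is, at EVERY fibre.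
Everything is read on `𝒳_s × E ≅ (𝒳 × E)_s` (§2) and transported along the isomorphism. FACT-FREE.
[cite: VoisinHodgeI2002, §6.2.3 Def. 6.24, Cor. 6.26, Rem. 6.27 and §7.1.2] [cite: Kleiman1968AlgebraicCycles, Thm. 2.9 and Thm. 2A11]
[cite: Andre1996Motifs, §1.1 and §1.3] [cite: Lieberman1968, main theorem] [cite: Hartshorne1977, III Prop. 10.1] -/
theorem exists_primitiveOneStepLift (f : 𝒳 ⟶ S) {n : ℕ} (hf : IsSmoothProjectiveFamily f n)
    (hA : ∀ s : ComplexPoints S, ∃ A' : AbelianVariety ℂ, A'.dim = n ∧ Nonempty (A'.X ≅ fiberOver f s))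
    (K : complexBetti 𝒳 2)
    (hK : ∀ s : ComplexPoints S, IsPolarizationClass n (fiberOver f s) (complexBetti.map (fiberι f s) 2 K))
    (E : AbelianVariety ℂ) (hE1 : E.dim = 1) {K_E : complexBetti E.X 2} (hKE : IsPolarizationClass E.dim E.X K_E)
    {p r : ℕ} (hn : 2 * p + (r + 1) = n) (W : complexBetti 𝒳 (2 * p))
    (hW : ∀ s : ComplexPoints S, IsRationalClass (complexBetti.map (fiberι f s) (2 * p) W) ∧
      IsOfHodgeType n (fiberOver f s) (2 * p) p p (complexBetti.map (fiberι f s) (2 * p) W))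
    (hP : ∀ s : ComplexPoints S, complexBetti.map (fiberι f s) (2 * p) W ∈
      primitiveClasses (complexBetti.map (fiberι f s) 2 K) n (2 * p)) :
    IsSmoothProjectiveFamily (fst 𝒳 E.X ≫ f) (n + E.dim) ∧
    (∀ s : ComplexPoints S, ∃ A'' : AbelianVariety ℂ, A''.dim = n + E.dim ∧
      Nonempty (A''.X ≅ fiberOver (fst 𝒳 E.X ≫ f) s)) ∧
    ∃ (K' : complexBetti (𝒳 ⊗ E.X) 2) (W' : complexBetti (𝒳 ⊗ E.X) (2 * (p + 1))),
      (∀ s : ComplexPoints S, IsPolarizationClass (n + E.dim) (fiberOver (fst 𝒳 E.X ≫ f) s)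
        (complexBetti.map (fiberι (fst 𝒳 E.X ≫ f) s) 2 K')) ∧
      (∀ s : ComplexPoints S, IsRationalClass (complexBetti.map (fiberι (fst 𝒳 E.X ≫ f) s) (2 * (p + 1)) W') ∧
        IsOfHodgeType (n + E.dim) (fiberOver (fst 𝒳 E.X ≫ f) s) (2 * (p + 1)) (p + 1) (p + 1)
          (complexBetti.map (fiberι (fst 𝒳 E.X ≫ f) s) (2 * (p + 1)) W')) ∧
      (∀ s : ComplexPoints S, complexBetti.map (fiberι (fst 𝒳 E.X ≫ f) s) (2 * (p + 1)) W' ∈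
        primitiveClasses (complexBetti.map (fiberι (fst 𝒳 E.X ≫ f) s) 2 K') (n + E.dim) (2 * (p + 1))) ∧
      ∀ s : ComplexPoints S,
        complexBetti.map (fiberι (fst 𝒳 E.X ≫ f) s) (2 * (p + 1)) W' ∈
            algebraicClasses (fiberOver (fst 𝒳 E.X ≫ f) s) (p + 1) ↔
          complexBetti.map (fiberι f s) (2 * p) W ∈ algebraicClasses (fiberOver f s) p := by
  have hE : IsSmoothProjective E.dim E.X := AbelianVariety.isSmoothProjective_holds
  have hf' : IsSmoothProjectiveFamily (fst 𝒳 E.X ≫ f) (n + E.dim) := isSmoothProjectiveFamily_fst_comp f hf hE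
  refine ⟨hf', exists_abelianVariety_iso_fiberOver_fst_comp f hA E,
    complexBetti.map (fst 𝒳 E.X) 2 K + complexBetti.map (snd 𝒳 E.X) 2 K_E,
    lefschetzOperator (complexBetti.map (fst 𝒳 E.X) 2 K) (two_add_two_mul p) (complexBetti.map (fst 𝒳 E.X) (2 * p) W) -
      ((r + 1 : ℕ) : ℂ) • lefschetzOperator (complexBetti.map (snd 𝒳 E.X) 2 K_E) (two_add_two_mul p)
        (complexBetti.map (fst 𝒳 E.X) (2 * p) W), ?_⟩
  -- read everything on `𝒳_s × E` through `e : 𝒳_s × E ≅ (𝒳 × E)_s`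
  have key : ∀ s : ComplexPoints S, ∃ e : fiberOver f s ⊗ E.X ≅ fiberOver (fst 𝒳 E.X ≫ f) s,
      complexBetti.map (fiberι (fst 𝒳 E.X ≫ f) s) 2 (complexBetti.map (fst 𝒳 E.X) 2 K + complexBetti.map (snd 𝒳 E.X) 2 K_E) =
        complexBetti.map e.inv 2 (complexBetti.map (fst (fiberOver f s) E.X) 2 (complexBetti.map (fiberι f s) 2 K) +
          complexBetti.map (snd (fiberOver f s) E.X) 2 K_E) ∧
      complexBetti.map (fiberι (fst 𝒳 E.X ≫ f) s) (2 * (p + 1))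
          (lefschetzOperator (complexBetti.map (fst 𝒳 E.X) 2 K) (two_add_two_mul p) (complexBetti.map (fst 𝒳 E.X) (2 * p) W) -
            ((r + 1 : ℕ) : ℂ) • lefschetzOperator (complexBetti.map (snd 𝒳 E.X) 2 K_E) (two_add_two_mul p)
              (complexBetti.map (fst 𝒳 E.X) (2 * p) W)) =
        complexBetti.map e.inv (2 * (p + 1))
          (lefschetzOperator (complexBetti.map (fst (fiberOver f s) E.X) 2 (complexBetti.map (fiberι f s) 2 K))
              (two_add_two_mul p) (complexBetti.map (fst (fiberOver f s) E.X) (2 * p) (complexBetti.map (fiberι f s) (2 * p) W)) -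
            ((r + 1 : ℕ) : ℂ) • lefschetzOperator (complexBetti.map (snd (fiberOver f s) E.X) 2 K_E) (two_add_two_mul p)
              (complexBetti.map (fst (fiberOver f s) E.X) (2 * p) (complexBetti.map (fiberι f s) (2 * p) W))) := by
    intro s
    obtain ⟨e, he⟩ := exists_iso_map_fiberι_fst_comp_eq f E.X s
    refine ⟨e, ?_, ?_⟩
    · rw [he, map_add, map_whiskerRight_map_fst, map_whiskerRight_map_snd]
    · rw [he, map_sub, map_smul, map_lefschetzOperator, map_lefschetzOperator, map_whiskerRight_map_fst,
        map_whiskerRight_map_fst, map_whiskerRight_map_snd]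
  refine ⟨fun s ↦ ?_, fun s ↦ ?_, fun s ↦ ?_, fun s ↦ ?_⟩
  · -- `K♯` polarises the fibre: exterior sum of two polarisation classes, transported along `e`
    obtain ⟨e, heK, -⟩ := key s
    rw [heK]
    exact IsPolarizationClass.map_of_iso (IsSmoothProjective.tensor_holds (hf.isSmoothProjective s) hE)
      (hf'.isSmoothProjective s) e.symm (isPolarizationClass_boxSum (hf.isSmoothProjective s) hE (hK s) hKE)
  · -- rational of type `(p+1, p+1)`
    obtain ⟨e, -, heW⟩ := key s
    rw [heW]
    exact ⟨(isRationalClass_primitiveLift E _ K_E (hK s).isRationalClass hKE.isRationalClass (hW s).1 _).map _,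
      (isOfHodgeType_map_iff_of_iso e.symm).2 (isOfHodgeType_primitiveLift E _ K_E (hf.isSmoothProjective s)
        (hK s).mem_algebraicClasses hKE.mem_algebraicClasses (hW s).2 _)⟩
  · -- primitive (defect `r`)
    obtain ⟨e, heK, heW⟩ := key s
    rw [heK, heW]
    exact map_mem_primitiveClasses e.inv (primitiveLift_mem_primitiveClasses E _ K_E hE1 hn (hP s))
  · -- same algebraicity locus
    obtain ⟨e, -, heW⟩ := key s
    obtain ⟨A', hA'dim, ⟨eA⟩⟩ := hA s
    rw [heW, show e.inv = e.symm.hom from rfl, mem_algebraicClasses_map_iff_of_iso e.symm]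
    exact ⟨mem_algebraicClasses_of_primitiveLift_mem E _ K_E (hf.isSmoothProjective s) hA'dim eA (hK s) hn _,
      fun h ↦ primitiveLift_mem_algebraicClasses E _ K_E (hf.isSmoothProjective s) (hK s).mem_algebraicClasses
        hKE.mem_algebraicClasses h _⟩

end Family

/-! ## §2 The induction on the Lefschetz defect (carrier level, fact-free) -/

section Defect

variable {𝒳 S : SchemeOver ℂ}

/-- **Row b02 restricted to fibrewise LEFSCHETZ-PRIMITIVE classes of the MIDDLE degree, from relative dimension `g` on** (file-local
notation, symbol for symbol the body of `Ring2.Hypotheses.AbelianSchemeVHC` with a global class `K` polarising every fibre and the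
binders `g ≤ n`, `2 ≤ p`, `2 * p = n`, `W| ∈ primitiveClasses (K|) n (2p)` inserted; the sequel `Ring2BindersAbelianSchemeVHCPrimitiveMiddle.lean`
declares the same notation). -/
local notation3 (prettyPrint := false) "AbelianSchemeVHCPrimitiveMiddleFrom[" g "]" =>
  ∀ ⦃n : ℕ⦄ ⦃𝒳 S : SchemeOver ℂ⦄ (f : 𝒳 ⟶ S), IsSmoothProjectiveFamily f n → g ≤ n → IrreducibleSpace S.left →
    AlgebraicGeometry.Smooth S.hom →
    (∀ s : ComplexPoints S, ∃ A' : AbelianVariety ℂ, A'.dim = n ∧ Nonempty (A'.X ≅ fiberOver f s)) →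
    ∀ (K : complexBetti 𝒳 2),
      (∀ s : ComplexPoints S, IsPolarizationClass n (fiberOver f s) (complexBetti.map (fiberι f s) 2 K)) →
    ∀ (p : ℕ), 2 ≤ p → 2 * p = n → ∀ (W : complexBetti 𝒳 (2 * p)),
      (∀ s : ComplexPoints S, IsRationalClass (complexBetti.map (fiberι f s) (2 * p) W) ∧
        IsOfHodgeType n (fiberOver f s) (2 * p) p p (complexBetti.map (fiberι f s) (2 * p) W)) →
      (∀ s : ComplexPoints S, complexBetti.map (fiberι f s) (2 * p) W ∈
        primitiveClasses (complexBetti.map (fiberι f s) 2 K) n (2 * p)) →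
      (∃ s₀ : ComplexPoints S,
        complexBetti.map (fiberι f s₀) (2 * p) W ∈ algebraicClasses (fiberOver f s₀) p) →
      ∀ s : ComplexPoints S, complexBetti.map (fiberι f s) (2 * p) W ∈ algebraicClasses (fiberOver f s) p

/-- **THE INDUCTION ON THE LEFSCHETZ DEFECT.** If row b02 holds for fibrewise-primitive MIDDLE classes on abelian schemes of (even)
relative dimension `≥ g`, then it holds for fibrewise-primitive classes `W ∈ H²ᵖ`, `2 ≤ p`, of ANY defect `d = n - 2p` on
abelian schemes of relative dimension `n ≥ g` — for every global polarising class `K`, every anchor and every fibre. Induction on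
`d`: `d = 0` is the hypothesis; for `d = r + 1` the primitive one-step lift (§1) along an elliptic curve `E`
(`exists_abelianVariety_dim_eq_one`, polarised by `exists_isPolarizationClass`) produces on `𝒳 × E ⟶ S` — relative dimension
`n + 1 ≥ g`, abelian fibres — a fibrewise `K♯|`-primitive class `W♯ ∈ H^{2(p+1)}` of defect `r` with the SAME algebraicity
locus, to which the induction hypothesis applies. No quasi-projectivity of the total space is needed (the polarising class of
`𝒳 × E` is built from `K`). FACT-FREE. [cite: VoisinHodgeI2002, §6.2.3 Def. 6.24, Cor. 6.26 and Rem. 6.27]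
[cite: Kleiman1968AlgebraicCycles, Thm. 2.9 and Thm. 2A11] [cite: Lieberman1968, main theorem]
[cite: BrosnanFangNiePearlstein2009, §6 Lemma 48] [cite: CharlesSchnell2014Notes, Conj. 11.3.1 and Prop. 11.3.11 (proof)] -/
theorem map_fiberι_mem_algebraicClasses_of_primitiveMiddleFrom_of_mem_primitiveClasses {g : ℕ}
    (h : AbelianSchemeVHCPrimitiveMiddleFrom[g]) (d : ℕ) :
    ∀ ⦃n : ℕ⦄ ⦃𝒳 S : SchemeOver ℂ⦄ (f : 𝒳 ⟶ S), IsSmoothProjectiveFamily f n → g ≤ n → IrreducibleSpace S.left →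
      AlgebraicGeometry.Smooth S.hom →
      (∀ s : ComplexPoints S, ∃ A' : AbelianVariety ℂ, A'.dim = n ∧ Nonempty (A'.X ≅ fiberOver f s)) →
      ∀ (K : complexBetti 𝒳 2),
        (∀ s : ComplexPoints S, IsPolarizationClass n (fiberOver f s) (complexBetti.map (fiberι f s) 2 K)) →
      ∀ (p : ℕ), 2 ≤ p → 2 * p + d = n → ∀ (W : complexBetti 𝒳 (2 * p)),
        (∀ s : ComplexPoints S, IsRationalClass (complexBetti.map (fiberι f s) (2 * p) W) ∧
          IsOfHodgeType n (fiberOver f s) (2 * p) p p (complexBetti.map (fiberι f s) (2 * p) W)) →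
        (∀ s : ComplexPoints S, complexBetti.map (fiberι f s) (2 * p) W ∈
          primitiveClasses (complexBetti.map (fiberι f s) 2 K) n (2 * p)) →
        (∃ s₀ : ComplexPoints S,
          complexBetti.map (fiberι f s₀) (2 * p) W ∈ algebraicClasses (fiberOver f s₀) p) →
        ∀ s : ComplexPoints S, complexBetti.map (fiberι f s) (2 * p) W ∈ algebraicClasses (fiberOver f s) p := by
  induction d with
  | zero =>
    intro n 𝒳 S f hf hgn hirr hsm habel K hK p h2 hpn W hW hP h₀ s
    exact h f hf hgn hirr hsm habel K hK p h2 (by omega) W hW hP h₀ s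
  | succ r ih =>
    intro n 𝒳 S f hf hgn hirr hsm habel K hK p h2 hpn W hW hP h₀ s
    obtain ⟨s₀, h₀⟩ := h₀
    obtain ⟨E, hE1⟩ := exists_abelianVariety_dim_eq_one ℂ
    obtain ⟨K_E, hKE⟩ := exists_isPolarizationClass (AbelianVariety.isSmoothProjective_holds (A := E))
    obtain ⟨hf', habel', K', W', hK', hW', hP', hiff⟩ := exists_primitiveOneStepLift f hf habel K hK E hE1 hKE hpn W hW hP
    exact (hiff s).1 (ih (fst 𝒳 E.X ≫ f) hf' (by omega) hirr hsm habel' K' hK' (p + 1) (by omega) (by omega) W' hW' hP'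
      ⟨s₀, (hiff s₀).2 h₀⟩ s)

end Defect

/-! ## Audit: fact-free (closures are the three standard axioms; no named fact, no `HC_CM`) -/

#print axioms Summit.HodgeConjecture.HodgeConjecture.Ring2.Binders.exists_primitiveOneStepLift
#print axioms Summit.HodgeConjecture.HodgeConjecture.Ring2.Binders.map_fiberι_mem_algebraicClasses_of_primitiveMiddleFrom_of_mem_primitiveClasses

end Summit.HodgeConjecture.HodgeConjecture.Ring2.Binders

end
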